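import Summits.CriticalPhenomena.PercolationContinuityZ3.Theorems.PercNearOneGluingNoHeavyLowerTailSahiTwoChainWRDefs
import Literature.Combinatorics.Sahi2008.Symmetry
import HarnessLib

/-!
# The without-replacement two-chain functional `Ẽ_n`: multilinearity and symmetry

Support file of the one-cut programme (crux `NoHeavyLowerTail`, stmt-CriticalPhenomena-4575; cell `prim-masterthm`, seat P3, gen 16;
`run/shared/lean/prim/prim-masterthm/prim-masterthm-p3/HIERARCHY.md` §24; memo
`run/shared/lean/prim/prim-masterthm/FROM-prim-masterthm-p3-g16-TWO-CHAIN-COEFFICIENTS.md`).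

For the functional `SahiTwoChain.et X Y n f` of `…SahiTwoChainWRDefs` (Sahi's `E_n` with the blocks of a set partition read at a
uniformly random partial permutation pattern of the grid `X × Y` instead of at independent points; defined by a Lieb–Sahi-type
recursion [LiebSahi2021, Prop. 3.3] whose product term lives on the reduced grid) this file proves, along the recursion:
* `et_update_lin` (+ `add/sub/smul/zero`) — linearity in every slot (as the tree's `Sahi2008.sahiE_update_lin`);
* `et_comp_perm` — **symmetry under every permutation of the slots** (as the tree's `Sahi2008.sahiE_comp_perm`: tail
  transpositions from the recursion, the head transposition `(0 1)` by the double expansion `et_cons_cons_expand`, in which the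
  new term — two successively deleted points — is symmetric because the set of ordered pairs of "non-attacking" points is
  (`sum_offGrid_comm`) and deleting in either order gives the same grid).
Everything PROVED, standard axioms; no new definitions. [this work]
-/

noncomputable section

open scoped Classical

namespace Summit.CriticalPhenomena.PercolationContinuityZ3.Theorems

open Finset Function
open Literature.Combinatorics.Sahi2008

namespace SahiTwoChain

variable {α β : Type*}

/-! ### Multilinearity -/

/-- `Σ_z (a g + b h) z * c z = a Σ g c + b Σ h c` (plumbing). [this work] -/
private theorem sum_lin_mul (S : Finset (α × β)) (a b : ℝ) (g h c : α × β → ℝ) :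
    ∑ z ∈ S, (a • g + b • h) z * c z = a * ∑ z ∈ S, g z * c z + b * ∑ z ∈ S, h z * c z := by
  simp only [Pi.add_apply, Pi.smul_apply, smul_eq_mul, mul_sum]
  rw [← sum_add_distrib]
  refine sum_congr rfl fun z _ => by ring

/-- `Σ_z c z * (a u z + b v z) = a Σ c u + b Σ c v` (plumbing). [this work] -/
private theorem sum_mul_lin (S : Finset (α × β)) (a b : ℝ) (c u v : α × β → ℝ) :
    ∑ z ∈ S, c z * (a * u z + b * v z) = a * ∑ z ∈ S, c z * u z + b * ∑ z ∈ S, c z * v z := by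
  simp only [mul_sum]
  rw [← sum_add_distrib]
  refine sum_congr rfl fun z _ => by ring

/-- **`Ẽ_n` is linear in each slot.** [this work] -/
theorem et_update_lin : ∀ (n : ℕ) (X : Finset α) (Y : Finset β) (f : Fin n → α × β → ℝ) (i : Fin n) (a b : ℝ)
    (g h : α × β → ℝ),
    et X Y n (update f i (a • g + b • h)) = a * et X Y n (update f i g) + b * et X Y n (update f i h)
  | 0, _, _, _, i, _, _, _, _ => i.elim0
  | 1, X, Y, f, i, a, b, g, h => by
    have hi : i = 0 := Subsingleton.elim i 0
    subst hi
    simp only [et_one, update_self, Pi.add_apply, Pi.smul_apply, smul_eq_mul, sum_add_distrib, ← mul_sum]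
    ring
  | n + 2, X, Y, f, i, a, b, g, h => by
    refine Fin.cases ?_ (fun k => ?_) i
    · -- slot `0`
      simp only [et_succ_succ, Fin.tail_update_zero, update_self]
      have hmul : ∀ j : Fin (n + 1),
          Fin.tail f j * (a • g + b • h) = a • (Fin.tail f j * g) + b • (Fin.tail f j * h) := by
        intro j; funext x; simp only [Pi.mul_apply, Pi.add_apply, Pi.smul_apply, smul_eq_mul]; ring
      simp only [hmul, et_update_lin (n + 1), sum_lin_mul]
      rw [sum_add_distrib, ← mul_sum, ← mul_sum]
      ring
    · -- slot `k.succ`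
      simp only [et_succ_succ, Fin.tail_update_succ]
      rw [update_of_ne (Fin.succ_ne_zero k).symm, update_of_ne (Fin.succ_ne_zero k).symm,
        update_of_ne (Fin.succ_ne_zero k).symm]
      set tf := Fin.tail f with htf
      have hterm : ∀ j : Fin (n + 1),
          et X Y (n + 1) (update (update tf k (a • g + b • h)) j (update tf k (a • g + b • h) j * f 0)) =
            a * et X Y (n + 1) (update (update tf k g) j (update tf k g j * f 0)) +
              b * et X Y (n + 1) (update (update tf k h) j (update tf k h j * f 0)) := by
        intro j
        by_cases hjk : j = k
        · subst hjk
          simp only [update_self, update_idem]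
          have hmul : (a • g + b • h) * f 0 = a • (g * f 0) + b • (h * f 0) := by
            funext x; simp only [Pi.mul_apply, Pi.add_apply, Pi.smul_apply, smul_eq_mul]; ring
          rw [hmul, et_update_lin (n + 1)]
        · rw [update_of_ne hjk, update_of_ne hjk, update_of_ne hjk, update_comm (Ne.symm hjk),
            update_comm (Ne.symm hjk), update_comm (Ne.symm hjk), et_update_lin (n + 1)]
      simp only [hterm, et_update_lin (n + 1), sum_mul_lin]
      rw [sum_add_distrib, ← mul_sum, ← mul_sum]
      ring

/-- Additivity in each slot. [this work] -/
theorem et_update_add {n : ℕ} (X : Finset α) (Y : Finset β) (f : Fin n → α × β → ℝ) (i : Fin n) (g h : α × β → ℝ) :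
    et X Y n (update f i (g + h)) = et X Y n (update f i g) + et X Y n (update f i h) := by
  have key := et_update_lin n X Y f i 1 1 g h
  simp only [one_smul, one_mul] at key
  exact key

/-- Subtraction in each slot. [this work] -/
theorem et_update_sub {n : ℕ} (X : Finset α) (Y : Finset β) (f : Fin n → α × β → ℝ) (i : Fin n) (g h : α × β → ℝ) :
    et X Y n (update f i (g - h)) = et X Y n (update f i g) - et X Y n (update f i h) := by
  have key := et_update_lin n X Y f i 1 (-1) g h
  simp only [one_smul, neg_smul, one_mul, neg_mul, ← sub_eq_add_neg] at key
  exact key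

/-- Homogeneity in each slot. [this work] -/
theorem et_update_smul {n : ℕ} (X : Finset α) (Y : Finset β) (f : Fin n → α × β → ℝ) (i : Fin n) (c : ℝ) (g : α × β → ℝ) :
    et X Y n (update f i (c • g)) = c * et X Y n (update f i g) := by
  have key := et_update_lin n X Y f i c 0 g g
  simp only [zero_smul, add_zero, zero_mul] at key
  exact key

/-- A zero slot kills `Ẽ_n`. [this work] -/
theorem et_update_zero {n : ℕ} (X : Finset α) (Y : Finset β) (f : Fin n → α × β → ℝ) (i : Fin n) :
    et X Y n (update f i 0) = 0 := by
  have key := et_update_lin n X Y f i 0 0 0 0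
  simp only [zero_smul, add_zero, zero_mul] at key
  exact key


/-! ### Symmetry under permutations of the slots -/

/-- (A) Permuting the tail slots does not change `Ẽ_{n+2}`, given symmetry of `Ẽ_{n+1}` on every grid. [this work] -/
theorem et_cons_comp_perm (n : ℕ)
    (ih : ∀ (X : Finset α) (Y : Finset β) (τ : Equiv.Perm (Fin (n + 1))) (g : Fin (n + 1) → α × β → ℝ),
      et X Y (n + 1) (fun i => g (τ i)) = et X Y (n + 1) g)
    (X : Finset α) (Y : Finset β) (a : α × β → ℝ) (g : Fin (n + 1) → α × β → ℝ) (τ : Equiv.Perm (Fin (n + 1))) :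
    et X Y (n + 2) (Fin.cons a (fun i => g (τ i)) : Fin (n + 2) → α × β → ℝ) =
      et X Y (n + 2) (Fin.cons a g : Fin (n + 2) → α × β → ℝ) := by
  rw [et_cons, et_cons]
  simp_rw [ih]
  congr 1
  have hupd : ∀ i : Fin (n + 1), update (fun j => g (τ j)) i (g (τ i) * a) =
      fun j => update g (τ i) (g (τ i) * a) (τ j) := by
    intro i
    have h := update_comp_equiv g τ (τ i) (g (τ i) * a)
    rw [Equiv.symm_apply_apply] at h
    exact h.symm
  simp_rw [hupd, ih]
  exact Equiv.sum_comp τ (fun i => et X Y (n + 1) (update g i (g i * a)))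

/-- Exchanging the roles of two "non-attacking" points: the double sum over `z ∈ X × Y`, `z' ∈ (X∖z.1) × (Y∖z.2)` is symmetric.
[this work] -/
theorem sum_offGrid_comm (X : Finset α) (Y : Finset β) (F : α × β → α × β → ℝ) :
    ∑ z ∈ X ×ˢ Y, ∑ z' ∈ (X.erase z.1) ×ˢ (Y.erase z.2), F z z' =
      ∑ z ∈ X ×ˢ Y, ∑ z' ∈ (X.erase z.1) ×ˢ (Y.erase z.2), F z' z := by
  rw [Finset.sum_comm' (t' := X ×ˢ Y) (s' := fun z' => (X.erase z'.1) ×ˢ (Y.erase z'.2))]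
  intro z z'
  simp only [Finset.mem_product, Finset.mem_erase]
  tauto

/-- The reduced grid has `(|X|−1)(|Y|−1)` points, for every deleted point of `X × Y` (plumbing). [this work] -/
theorem card_erase_mul_card_erase {X : Finset α} {Y : Finset β} {z : α × β} (hz : z ∈ X ×ˢ Y) :
    ((X.erase z.1).card : ℝ) * (Y.erase z.2).card = ((X.card - 1 : ℕ) : ℝ) * ((Y.card - 1 : ℕ) : ℝ) := by
  rw [Finset.mem_product] at hz
  rw [Finset.card_erase_of_mem hz.1, Finset.card_erase_of_mem hz.2]

/-- Deleting two non-attacking points in either order gives the same grid (plumbing). [this work] -/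
theorem erase_erase_comm_fst (X : Finset α) (z z' : α × β) : (X.erase z.1).erase z'.1 = (X.erase z'.1).erase z.1 :=
  Finset.erase_right_comm

/-- (B) The double expansion of the recursion: `Ẽ_{n+3}(a, b, r)` in terms of `Ẽ_{n+1}` on the grid and its reductions. [this work] -/
theorem et_cons_cons_expand (n : ℕ) (X : Finset α) (Y : Finset β) (a b : α × β → ℝ) (r : Fin (n + 1) → α × β → ℝ) :
    et X Y (n + 3) (Fin.cons a (Fin.cons b r : Fin (n + 2) → α × β → ℝ) : Fin (n + 3) → α × β → ℝ) =
      ((∑ k, et X Y (n + 1) (update r k (r k * (b * a)))) -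
        (∑ z ∈ X ×ˢ Y, (b * a) z * et (X.erase z.1) (Y.erase z.2) (n + 1) r) / ((X.card : ℝ) * Y.card))
      + (∑ j, ∑ k, et X Y (n + 1) (update (update r j (r j * a)) k (update r j (r j * a) k * b)))
      - (∑ z ∈ X ×ˢ Y, b z * ∑ j, et (X.erase z.1) (Y.erase z.2) (n + 1) (update r j (r j * a))) / ((X.card : ℝ) * Y.card)
      - (∑ z ∈ X ×ˢ Y, a z * ∑ k, et (X.erase z.1) (Y.erase z.2) (n + 1) (update r k (r k * b))) / ((X.card : ℝ) * Y.card)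
      + ((∑ z ∈ X ×ˢ Y, ∑ z' ∈ (X.erase z.1) ×ˢ (Y.erase z.2),
            a z * b z' * et ((X.erase z.1).erase z'.1) ((Y.erase z.2).erase z'.2) (n + 1) r) /
          (((X.card - 1 : ℕ) : ℝ) * ((Y.card - 1 : ℕ) : ℝ))) / ((X.card : ℝ) * Y.card) := by
  rw [et_cons, Fin.sum_univ_succ, Fin.cons_zero, Fin.update_cons_zero]
  simp only [Fin.cons_succ, ← Fin.cons_update, et_cons]
  have h6 : ∀ z ∈ X ×ˢ Y,
      a z * ((∑ k, et (X.erase z.1) (Y.erase z.2) (n + 1) (update r k (r k * b))) -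
        (∑ z' ∈ (X.erase z.1) ×ˢ (Y.erase z.2), b z' * et ((X.erase z.1).erase z'.1) ((Y.erase z.2).erase z'.2) (n + 1) r) /
          (((X.erase z.1).card : ℝ) * (Y.erase z.2).card)) =
      a z * (∑ k, et (X.erase z.1) (Y.erase z.2) (n + 1) (update r k (r k * b))) -
        (∑ z' ∈ (X.erase z.1) ×ˢ (Y.erase z.2), a z * b z' * et ((X.erase z.1).erase z'.1) ((Y.erase z.2).erase z'.2) (n + 1) r) /
          (((X.card - 1 : ℕ) : ℝ) * ((Y.card - 1 : ℕ) : ℝ)) := by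
    intro z hz
    rw [card_erase_mul_card_erase hz, mul_sub, mul_div_assoc']
    congr 2
    rw [mul_sum]
    exact sum_congr rfl fun z' _ => by ring
  rw [sum_congr rfl h6, sum_sub_distrib, sum_sub_distrib, ← sum_div, ← sum_div]
  have h4 : ∑ j, ∑ z ∈ X ×ˢ Y, b z * et (X.erase z.1) (Y.erase z.2) (n + 1) (update r j (r j * a)) =
      ∑ z ∈ X ×ˢ Y, b z * ∑ j, et (X.erase z.1) (Y.erase z.2) (n + 1) (update r j (r j * a)) := by
    rw [sum_comm]
    exact sum_congr rfl fun z _ => by rw [mul_sum]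
  have h5 : ∑ z ∈ X ×ˢ Y, a z * ∑ k, et (X.erase z.1) (Y.erase z.2) (n + 1) (update r k (r k * b)) =
      ∑ z ∈ X ×ˢ Y, a z * ∑ k, et (X.erase z.1) (Y.erase z.2) (n + 1) (update r k (r k * b)) := rfl
  rw [h4]
  ring

/-- (B') Swapping the two head slots does not change `Ẽ_{n+3}`. [this work] -/
theorem et_cons_cons_comm (n : ℕ) (X : Finset α) (Y : Finset β) (a b : α × β → ℝ) (r : Fin (n + 1) → α × β → ℝ) :
    et X Y (n + 3) (Fin.cons a (Fin.cons b r : Fin (n + 2) → α × β → ℝ) : Fin (n + 3) → α × β → ℝ) =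
      et X Y (n + 3) (Fin.cons b (Fin.cons a r : Fin (n + 2) → α × β → ℝ) : Fin (n + 3) → α × β → ℝ) := by
  rw [et_cons_cons_expand, et_cons_cons_expand]
  have hU : ∀ j k : Fin (n + 1), update (update r j (r j * a)) k (update r j (r j * a) k * b) =
      update (update r k (r k * b)) j (update r k (r k * b) j * a) := by
    intro j k
    by_cases hjk : j = k
    · subst hjk
      simp only [update_self, update_idem]
      congr 1
      ring
    · rw [update_of_ne (Ne.symm hjk), update_of_ne hjk, update_comm hjk]
  have hD : (∑ j, ∑ k, et X Y (n + 1) (update (update r j (r j * a)) k (update r j (r j * a) k * b))) =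
      ∑ j, ∑ k, et X Y (n + 1) (update (update r j (r j * b)) k (update r j (r j * b) k * a)) := by
    rw [Finset.sum_comm]
    exact Finset.sum_congr rfl fun k _ => Finset.sum_congr rfl fun j _ => by rw [hU]
  have hK : (∑ z ∈ X ×ˢ Y, ∑ z' ∈ (X.erase z.1) ×ˢ (Y.erase z.2),
      a z * b z' * et ((X.erase z.1).erase z'.1) ((Y.erase z.2).erase z'.2) (n + 1) r) =
      ∑ z ∈ X ×ˢ Y, ∑ z' ∈ (X.erase z.1) ×ˢ (Y.erase z.2),
        b z * a z' * et ((X.erase z.1).erase z'.1) ((Y.erase z.2).erase z'.2) (n + 1) r := by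
    rw [sum_offGrid_comm]
    refine sum_congr rfl fun z _ => sum_congr rfl fun z' _ => ?_
    rw [erase_erase_comm_fst X z' z, show (Y.erase z'.2).erase z.2 = (Y.erase z.2).erase z'.2 from Finset.erase_right_comm,
      mul_comm (a z')]
  rw [hD, hK, mul_comm b a]
  ring

/-- Symmetry of `Ẽ_2`. [this work] -/
theorem et_two_comp_perm (X : Finset α) (Y : Finset β) (σ : Equiv.Perm (Fin 2)) (f : Fin 2 → α × β → ℝ) :
    et X Y 2 (fun i => f (σ i)) = et X Y 2 f := by
  have h2 : ∀ g : Fin 2 → α × β → ℝ, et X Y 2 g =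
      (∑ z ∈ X ×ˢ Y, (g 1 * g 0) z) / ((X.card : ℝ) * Y.card) -
        ((∑ z ∈ X ×ˢ Y, ∑ z' ∈ (X.erase z.1) ×ˢ (Y.erase z.2), g 0 z * g 1 z') /
          (((X.card - 1 : ℕ) : ℝ) * ((Y.card - 1 : ℕ) : ℝ))) / ((X.card : ℝ) * Y.card) := by
    intro g
    rw [et_succ_succ, Fin.sum_univ_one, et_one, update_self]
    have h1 : Fin.tail g 0 = g 1 := rfl
    have hB : ∑ z ∈ X ×ˢ Y, g 0 z * et (X.erase z.1) (Y.erase z.2) 1 (Fin.tail g) =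
        (∑ z ∈ X ×ˢ Y, ∑ z' ∈ (X.erase z.1) ×ˢ (Y.erase z.2), g 0 z * g 1 z') /
          (((X.card - 1 : ℕ) : ℝ) * ((Y.card - 1 : ℕ) : ℝ)) := by
      rw [sum_div]
      refine sum_congr rfl fun z hz => ?_
      rw [et_one, card_erase_mul_card_erase hz, mul_div_assoc', mul_sum, h1]
    rw [hB, h1]
  rw [h2, h2]
  by_cases h : σ 0 = 0
  · have h1 : σ 1 = 1 := by
      have : σ 1 ≠ 0 := fun h' => by
        have := σ.injective (h'.trans h.symm); exact absurd this (by decide)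
      exact Fin.eq_one_of_ne_zero _ this
    rw [h, h1]
  · have h0 : σ 0 = 1 := Fin.eq_one_of_ne_zero _ h
    have h1 : σ 1 = 0 := by
      by_contra h'
      have := Fin.eq_one_of_ne_zero _ h'
      exact absurd (σ.injective (h0.trans this.symm)) (by decide)
    rw [h0, h1, mul_comm (f 0) (f 1), sum_offGrid_comm]
    simp_rw [mul_comm (f 1 _) (f 0 _)]

/-! ### (C) transpositions, then all permutations -/

/-- A transposition of two tail indices, given symmetry one level down. [this work] -/
theorem et_comp_swap_succ (n : ℕ)
    (ih : ∀ (X : Finset α) (Y : Finset β) (τ : Equiv.Perm (Fin (n + 2))) (g : Fin (n + 2) → α × β → ℝ),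
      et X Y (n + 2) (fun i => g (τ i)) = et X Y (n + 2) g)
    (X : Finset α) (Y : Finset β) (x' y' : Fin (n + 2)) (g : Fin (n + 3) → α × β → ℝ) :
    et X Y (n + 3) (fun i => g (Equiv.swap x'.succ y'.succ i)) = et X Y (n + 3) g := by
  rw [comp_swap_succ_succ, et_cons_comp_perm (n + 1) ih X Y (g 0) (Fin.tail g) (Equiv.swap x' y'),
    Fin.cons_self_tail]

/-- The head transposition `(0 1)`. [this work] -/
theorem et_comp_swap_zero_one (n : ℕ) (X : Finset α) (Y : Finset β) (g : Fin (n + 3) → α × β → ℝ) :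
    et X Y (n + 3) (fun i => g (Equiv.swap 0 1 i)) = et X Y (n + 3) g := by
  rw [comp_swap_zero_one, et_cons_cons_comm, ← eq_cons_cons]

/-- Transpositions `(0 y)`, given symmetry one level down. [this work] -/
theorem et_comp_swap_zero (n : ℕ)
    (ih : ∀ (X : Finset α) (Y : Finset β) (τ : Equiv.Perm (Fin (n + 2))) (g : Fin (n + 2) → α × β → ℝ),
      et X Y (n + 2) (fun i => g (τ i)) = et X Y (n + 2) g)
    (X : Finset α) (Y : Finset β) (y : Fin (n + 3)) (g : Fin (n + 3) → α × β → ℝ) :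
    et X Y (n + 3) (fun i => g (Equiv.swap 0 y i)) = et X Y (n + 3) g := by
  by_cases hy : y = 0
  · subst hy
    simp only [Equiv.swap_self, Equiv.refl_apply]
  obtain ⟨y', rfl⟩ := Fin.exists_succ_eq.2 hy
  have h1 : (1 : Fin (n + 3)) = (0 : Fin (n + 2)).succ := rfl
  set g₁ : Fin (n + 3) → α × β → ℝ := fun k => g (Equiv.swap 1 y'.succ k) with hg₁
  set g₂ : Fin (n + 3) → α × β → ℝ := fun j => g₁ (Equiv.swap 0 1 j) with hg₂
  have hfun : (fun i => g (Equiv.swap 0 y'.succ i)) = fun i => g₂ (Equiv.swap 1 y'.succ i) := by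
    funext i
    simp only [hg₂, hg₁, swap_zero_eq_conj hy, Equiv.Perm.mul_apply]
  have e1 : et X Y (n + 3) (fun i => g₂ (Equiv.swap 1 y'.succ i)) = et X Y (n + 3) g₂ := by
    rw [h1]; exact et_comp_swap_succ n ih X Y 0 y' g₂
  have e2 : et X Y (n + 3) g₂ = et X Y (n + 3) g₁ := et_comp_swap_zero_one n X Y g₁
  have e3 : et X Y (n + 3) g₁ = et X Y (n + 3) g := by
    rw [hg₁, h1]; exact et_comp_swap_succ n ih X Y 0 y' g
  rw [hfun, e1, e2, e3]

/-- Any transposition, given symmetry one level down. [this work] -/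
theorem et_comp_swap (n : ℕ)
    (ih : ∀ (X : Finset α) (Y : Finset β) (τ : Equiv.Perm (Fin (n + 2))) (g : Fin (n + 2) → α × β → ℝ),
      et X Y (n + 2) (fun i => g (τ i)) = et X Y (n + 2) g)
    (X : Finset α) (Y : Finset β) (x y : Fin (n + 3)) (g : Fin (n + 3) → α × β → ℝ) :
    et X Y (n + 3) (fun i => g (Equiv.swap x y i)) = et X Y (n + 3) g := by
  by_cases hx : x = 0
  · subst hx
    exact et_comp_swap_zero n ih X Y y g
  by_cases hy : y = 0
  · subst hy
    rw [Equiv.swap_comm]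
    exact et_comp_swap_zero n ih X Y x g
  obtain ⟨x', rfl⟩ := Fin.exists_succ_eq.2 hx
  obtain ⟨y', rfl⟩ := Fin.exists_succ_eq.2 hy
  exact et_comp_swap_succ n ih X Y x' y' g

/-- **`Ẽ_n` is symmetric**: `Ẽ_n(f_{σ(0)},…,f_{σ(n−1)}) = Ẽ_n(f_0,…,f_{n−1})` for every permutation `σ` and every grid. [this work] -/
theorem et_comp_perm : ∀ (n : ℕ) (X : Finset α) (Y : Finset β) (σ : Equiv.Perm (Fin n)) (f : Fin n → α × β → ℝ),
    et X Y n (fun i => f (σ i)) = et X Y n f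
  | 0, X, Y, σ, f => by simp [et_zero]
  | 1, X, Y, σ, f => by
    have : (fun i => f (σ i)) = f := funext fun i => by rw [Subsingleton.elim (σ i) i]
    rw [this]
  | 2, X, Y, σ, f => et_two_comp_perm X Y σ f
  | n + 3, X, Y, σ, f => by
    induction σ using Equiv.Perm.swap_induction_on generalizing f with
    | one => rfl
    | swap_mul τ x y _ ih =>
      have e1 : et X Y (n + 3) (fun i => f ((Equiv.swap x y * τ) i)) =
          et X Y (n + 3) (fun i => (fun j => f (Equiv.swap x y j)) (τ i)) := by
        simp only [Equiv.Perm.mul_apply]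
      rw [e1, ih (fun j => f (Equiv.swap x y j))]
      exact et_comp_swap n (fun X Y => et_comp_perm (n + 2) X Y) X Y x y f

/-- Symmetric form of `update`: moving a slot to the front (plumbing used with `et_comp_perm`). [this work] -/
theorem et_update_eq_of_perm {n : ℕ} (X : Finset α) (Y : Finset β) (σ : Equiv.Perm (Fin n)) (f : Fin n → α × β → ℝ) :
    et X Y n (f ∘ σ) = et X Y n f :=
  et_comp_perm n X Y σ f


end SahiTwoChain

end Summit.CriticalPhenomena.PercolationContinuityZ3.Theorems
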